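import Summits.PneNP.PneNP.Theorems.ChebyshevTracialDesignCrossingPinTracial
import Summits.PneNP.PneNP.Theorems.ChebyshevTracialDesignDegreeOneFace
import HarnessLib

/-!
# Cell pnp-psdrank, route `ChebyshevTracialDesign`: CROSSING LINEAR FORMS ARE NEGLIGIBLE UNDER EVERY MASK — for any `f` with `|f| ≤ 1` and
# any matching-dependent pair-antisymmetric test vectors `v_M` (`|v_M| ≤ 1`): `|Σ_M Σ_U W(U,M)·f(U)·(v_M·x_U)²| ≤ (n⁴/4)·(Σ|w_c|)·√P_{D−4}` —
# the NULL BLOCK of the conditional-Grigoriev matrix `F_M[f]` is two-sidedly small, r-free (crux `TracialDecayExp20`, stmt-PneNP-19878)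

Brick 99 (prover g18; MEMO-21 §3(c'), §5(2γ)). Brick 98 (`…DegreeOneFace`) computed the `f ≡ 1` face of the localised moment matrix
`F_M[f] = Σ_U W(U,M) f(U) x_U x_Uᵀ` and found its null space: the PAIR-ANTISYMMETRIC vectors (`v_{π_M p} = −v_p`), i.e. the crossing linear forms
`v·x_U = ½ Σ_p v_p (x_p − x_{π_M p})`. The toy numerics (MEMO-21 §7) located the whole positive part of `F_M[f]` for generic masks in exactly this
block. This file proves that the block is NEGLIGIBLE for EVERY mask, two-sidedly and on average over `M` with `M`-DEPENDENT test vectors (the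
operational form of 'sup inside the sum'):
* §1 **`crossingCell_scalar_abs_le`** — the scalar (`r = 1`) crossing-pin cell of brick 24b (`…CrossingPinTracial.crossingPin_tracial_value_le`):
  for a vertex pair `{p, p'}`, any `g` on the odd cuts with `|g| ≤ 1` vanishing unless `{p,p'}` crosses the cut, and any `y` on the matchings
  with `|y| ≤ 1` vanishing unless `{p,p'} ∈ M`: `|Σ_{U,M} W(U,M) g(U) y(M)| ≤ (Σ_c|w_c|)·√P_{D−4}` — SIGNED `g`, `y` allowed.
* §2 `sum_mul_indicator_eq_half_sum_diff` — for pair-antisymmetric `v`: `v·x_U = ½ Σ_p v_p (x_p(U) − x_{π p}(U))`;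
  **`crossingForms_value_abs_le`** — THE NULL BLOCK: for an exact design `(n, t = 2c'+1, T, D, B_v, C, w)` with `4 ≤ D ≤ 2c'`, `f : cuts → [−1,1]`,
  and `v : PM_n → ℝ^n` with `v_M` pair-antisymmetric w.r.t. `M` and `|v_M(p)| ≤ 1`:
  `|Σ_M Σ_U W(U,M) f(U) (v_M·x_U)²| ≤ (n⁴/4)·(Σ_c|w_c|)·√P_{D−4}`.
  MECHANISM: `(v_M·x_U)² = ¼ Σ_{p,q} v_M(p)v_M(q)(x_p − x_{π_M p})(x_q − x_{π_M q})`; re-indexing by `p' = π_M p`, `q' = π_M q` turns the `M`-sum, for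
  each of the `≤ n⁴` quadruples, into a crossing-pin cell of the FIXED pair `{p,p'}`: cut side `f·(x_p − x_{p'})(x_q − x_{q'})` (vanishes unless
  `{p,p'}` crosses), matching side `v_M(p)v_M(q)·1[π_M p = p', π_M q = q']` (vanishes unless `{p,p'} ∈ M`) — §1 each.
So of the three blocks of CG_1 (MEMO-21 §3(c')) the null block and — by the same argument with one crossing factor — the cross terms are
kernel-small for every mask; what remains of CG_1 is the PAIR-SYMMETRIC block (the pair-pinned design-value matrix), a statement about `f` alone.
[cite: Rothvoss2017, §2 and Lemma 7 (PDF pp. 6–8)] [cite: Grigoriev2001, Lemma 1.4 (PDF p. 8)] [cite: GriblingDelaatLaurent2019, §5]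
Stature: support/instrument (kernel lane, no defs, axioms standard). WHAT THIS IS NOT: nothing on the pair-symmetric block, no proof or
refutation of `TracialDecayExp20`, nothing on psd rank of P_PM(K_n), no P-vs-NP content. Supports stmt-PneNP-19878.
-/

set_option linter.dupNamespace false -- `Summit.PneNP.PneNP.…`: summit = sub-problem (D-0017)

noncomputable section

namespace Summit.PneNP.PneNP.Theorems.ChebyshevTracialDesignCrossingFormsNull

open Finset Matrix Literature.Barriers.PneNP Literature.Combinatorics.Optimization
open Literature.Combinatorics.SimpleGraph.CycleSpace
open Summit.PneNP.PneNP.Theorems.ChebyshevTracialDesignProfilePolynomial (card_pmatch_pos prod_atten_nonneg)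
open Summit.PneNP.PneNP.Theorems.ChebyshevTracialDesignTracialProfilePolynomial (sum_oddSet_card_eq)
open Summit.PneNP.PneNP.Theorems.ChebyshevTracialDesignCrossingPinTracial (crossingPin_tracial_value_le)

variable {n : ℕ}

/-! ### §1 The scalar crossing-pin cell, signed -/

/-- **THE SCALAR CROSSING-PIN CELL (signed functions).** For an exact design `(n, t = 2c'+1, T, D, B_v, C, w)` with `4 ≤ D ≤ 2c'`, a vertex pair
`{p,p'}`, `g : cuts → [−1,1]` vanishing unless `{p,p'}` crosses the cut, and `y : PM → [−1,1]` vanishing unless `{p,p'} ∈ M`: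
`|Σ_{U,M} W(U,M)·g(U)·y(M)| ≤ (Σ_c|w_c|)·√P_{D−4}`. [cite: Rothvoss2017, §2 and Lemma 7 (PDF pp. 6–8)] [cite: Grigoriev2001, Lemma 1.4 (PDF p. 8)] -/
theorem crossingCell_scalar_abs_le {c' T D : ℕ} {Bv : ℝ} {C : Finset ℕ} {w : ℕ → ℝ} (hn : Even n)
    (hdes : IsExactDesign n (2 * c' + 1) T D Bv C w) (hD : D ≤ 2 * c') (hD4 : 4 ≤ D) (p p' : Fin n)
    (g : OddSet n → ℝ) (hg : ∀ U : OddSet n, ¬ Crosses U.1 s(p, p') → g U = 0) (hg1 : ∀ U, |g U| ≤ 1)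
    (y : PMatch n → ℝ) (hy : ∀ M : PMatch n, s(p, p') ∉ M.1 → y M = 0) (hy1 : ∀ M, |y M| ≤ 1) :
    |∑ U : OddSet n, ∑ M : PMatch n, levelWeight n (2 * c' + 1) C w U M * (g U * y M)| ≤
      (∑ c ∈ C, |w c|) * Real.sqrt (∏ i ∈ range ((D - 4) / 2 + 1), ((2 * i + 1 : ℝ) / ((n : ℝ) - 2 * i))) := by
  have ht : 2 * (2 * c' + 1) + 2 ≤ n := hdes.2.1
  -- `1 × 1` embedding
  set X : OddSet n → Matrix (Fin 1) (Fin 1) ℝ := fun U => g U • (1 : Matrix (Fin 1) (Fin 1) ℝ) with hXdef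
  set Y : PMatch n → Matrix (Fin 1) (Fin 1) ℝ := fun M => y M • (1 : Matrix (Fin 1) (Fin 1) ℝ) with hYdef
  have hX : ∀ U : OddSet n, ¬ Crosses U.1 s(p, p') → X U = 0 := fun U hU => by rw [hXdef]; simp only [hg U hU, zero_smul]
  have hY : ∀ M : PMatch n, s(p, p') ∉ M.1 → Y M = 0 := fun M hM => by rw [hYdef]; simp only [hy M hM, zero_smul]
  have htr : ∀ U M, (X U * Y M).trace = g U * y M := fun U M => by
    rw [hXdef, hYdef]; simp [Matrix.trace, mul_comm]
  have h := crossingPin_tracial_value_le hn hdes hD hD4 p p' X Y hX hY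
  simp_rw [htr] at h
  refine h.trans (mul_le_mul_of_nonneg_left ?_ (sum_nonneg fun c _ => abs_nonneg _))
  -- the two Frobenius masses are at most `1` after normalisation
  have hPD := prod_atten_nonneg (n := n) (K := D - 4) (by omega)
  have hPm : (0 : ℝ) < Fintype.card (PMatch n) := by exact_mod_cast card_pmatch_pos hn
  have hCn : (0 : ℝ) < n.choose (2 * c' + 1) := by exact_mod_cast Nat.choose_pos (by omega)
  have hNX : (∑ U : OddSet n, if U.1.card = 2 * c' + 1 then ∑ a, ∑ b, X U a b ^ 2 else 0) / (n.choose (2 * c' + 1) : ℝ) ≤ 1 := by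
    rw [div_le_one hCn]
    calc (∑ U : OddSet n, if U.1.card = 2 * c' + 1 then ∑ a, ∑ b, X U a b ^ 2 else 0)
        ≤ ∑ U : OddSet n, (if U.1.card = 2 * c' + 1 then (1 : ℝ) else 0) := by
          refine sum_le_sum fun U _ => ?_
          split_ifs
          · rw [hXdef]
            simp only [Fin.sum_univ_one, Matrix.smul_apply, Matrix.one_apply_eq, smul_eq_mul, mul_one]
            have := hg1 U
            rw [sq_le_one_iff_abs_le_one]; exact this
          · exact le_rfl
      _ = (n.choose (2 * c' + 1) : ℝ) := by
          rw [sum_oddSet_card_eq ⟨c', rfl⟩ (fun _ => (1 : ℝ)), sum_const, card_powersetCard, card_univ, Fintype.card_fin, nsmul_eq_mul,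
            mul_one]
  have hNY : (∑ M : PMatch n, ∑ a, ∑ b, Y M a b ^ 2) / (Fintype.card (PMatch n) : ℝ) ≤ 1 := by
    rw [div_le_one hPm]
    calc ∑ M : PMatch n, ∑ a, ∑ b, Y M a b ^ 2 ≤ ∑ _M : PMatch n, (1 : ℝ) := by
          refine sum_le_sum fun M _ => ?_
          rw [hYdef]
          simp only [Fin.sum_univ_one, Matrix.smul_apply, Matrix.one_apply_eq, smul_eq_mul, mul_one]
          have := hy1 M
          rw [sq_le_one_iff_abs_le_one]; exact this
      _ = (Fintype.card (PMatch n) : ℝ) := by rw [sum_const, card_univ, nsmul_eq_mul, mul_one]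
  have hNX0 : 0 ≤ (∑ U : OddSet n, if U.1.card = 2 * c' + 1 then ∑ a, ∑ b, X U a b ^ 2 else 0) / (n.choose (2 * c' + 1) : ℝ) :=
    div_nonneg (sum_nonneg fun U _ => by split_ifs <;> [exact sum_nonneg fun a _ => sum_nonneg fun b _ => sq_nonneg _; exact le_rfl])
      hCn.le
  have hNY0 : 0 ≤ (∑ M : PMatch n, ∑ a, ∑ b, Y M a b ^ 2) / (Fintype.card (PMatch n) : ℝ) :=
    div_nonneg (sum_nonneg fun M _ => sum_nonneg fun a _ => sum_nonneg fun b _ => sq_nonneg _) hPm.le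
  calc Real.sqrt ((∏ i ∈ range ((D - 4) / 2 + 1), ((2 * i + 1 : ℝ) / ((n : ℝ) - 2 * i))) *
          ((∑ U : OddSet n, if U.1.card = 2 * c' + 1 then ∑ a, ∑ b, X U a b ^ 2 else 0) / (n.choose (2 * c' + 1) : ℝ)) *
          ((∑ M : PMatch n, ∑ a, ∑ b, Y M a b ^ 2) / (Fintype.card (PMatch n) : ℝ)))
      ≤ Real.sqrt ((∏ i ∈ range ((D - 4) / 2 + 1), ((2 * i + 1 : ℝ) / ((n : ℝ) - 2 * i))) * 1 * 1) :=
        Real.sqrt_le_sqrt (mul_le_mul (mul_le_mul_of_nonneg_left hNX hPD) hNY hNY0 (by positivity))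
    _ = Real.sqrt (∏ i ∈ range ((D - 4) / 2 + 1), ((2 * i + 1 : ℝ) / ((n : ℝ) - 2 * i))) := by rw [mul_one, mul_one]

/-! ### §2 The null block -/

/-- For a pair-antisymmetric `v` (`v_{πp} = −v_p`): `Σ_p v_p x_p(U) = ½ Σ_p v_p (x_p(U) − x_{πp}(U))`. [folklore] -/
theorem sum_mul_indicator_eq_half_sum_diff (M : PMatch n) (v : Fin n → ℝ) (hanti : ∀ p, v (M.2.partner p) = -v p) (x : Fin n → ℝ) :
    ∑ p, v p * x p = (1 / 2) * ∑ p, v p * (x p - x (M.2.partner p)) := by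
  set π : Equiv.Perm (Fin n) := Function.Involutive.toPerm (M.2.partner) (fun p => M.2.partner_partner p) with hπ
  -- `Σ_p v_p x_{πp} = Σ_p v_{πp} x_{ππp} = −Σ_p v_p x_p`
  have hre : ∑ p, v p * x (M.2.partner p) = -∑ p, v p * x p := by
    have h1 : ∑ p, v (M.2.partner p) * x (M.2.partner (M.2.partner p)) = ∑ p, v p * x (M.2.partner p) := by
      have := Equiv.sum_comp π (fun p => v p * x (M.2.partner p))
      simpa only [hπ, Function.Involutive.coe_toPerm] using this
    rw [← h1]
    simp_rw [M.2.partner_partner, hanti, neg_mul, sum_neg_distrib]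
  simp_rw [mul_sub, sum_sub_distrib, hre]
  ring

/-- **THE NULL BLOCK OF CG_1 IS NEGLIGIBLE FOR EVERY MASK.** For `n` even, an exact design `(n, t = 2c'+1, T, D, B_v, C, w)` with `4 ≤ D ≤ 2c'`,
a mask `f : cuts → [−1,1]`, and matching-dependent PAIR-ANTISYMMETRIC test vectors `v_M` (`v_M(π_M p) = −v_M(p)`, `|v_M(p)| ≤ 1`):
`|Σ_M Σ_U W(U,M)·f(U)·(v_M·x_U)²| ≤ (n⁴/4)·(Σ_c|w_c|)·√P_{D−4}`.
[cite: Rothvoss2017, §2 and Lemma 7 (PDF pp. 6–8)] [cite: Grigoriev2001, Lemma 1.4 (PDF p. 8)] [cite: GriblingDelaatLaurent2019, §5] -/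
theorem crossingForms_value_abs_le {c' T D : ℕ} {Bv : ℝ} {C : Finset ℕ} {w : ℕ → ℝ} (hn : Even n)
    (hdes : IsExactDesign n (2 * c' + 1) T D Bv C w) (hD : D ≤ 2 * c') (hD4 : 4 ≤ D)
    (f : OddSet n → ℝ) (hf : ∀ U, |f U| ≤ 1)
    (v : PMatch n → Fin n → ℝ) (hanti : ∀ M p, v M (M.2.partner p) = -v M p) (hv1 : ∀ M p, |v M p| ≤ 1) :
    |∑ M : PMatch n, ∑ U : OddSet n, levelWeight n (2 * c' + 1) C w U M *
        (f U * (∑ p, v M p * (if p ∈ U.1 then (1 : ℝ) else 0)) ^ 2)| ≤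
      (n : ℝ) ^ 4 / 4 * ((∑ c ∈ C, |w c|) * Real.sqrt (∏ i ∈ range ((D - 4) / 2 + 1), ((2 * i + 1 : ℝ) / ((n : ℝ) - 2 * i)))) := by
  classical
  set β : ℝ := (∑ c ∈ C, |w c|) * Real.sqrt (∏ i ∈ range ((D - 4) / 2 + 1), ((2 * i + 1 : ℝ) / ((n : ℝ) - 2 * i))) with hβ
  -- indicator and difference functions
  set x : OddSet n → Fin n → ℝ := fun U p => if p ∈ U.1 then (1 : ℝ) else 0 with hx
  set d : Fin n → Fin n → OddSet n → ℝ := fun p p' U => x U p - x U p' with hd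
  have hd1 : ∀ p p' U, |d p p' U| ≤ 1 := fun p p' U => by
    rw [hd, hx]; dsimp only; split_ifs <;> norm_num
  have hdcross : ∀ p p' (U : OddSet n), ¬ Crosses U.1 s(p, p') → d p p' U = 0 := by
    intro p p' U hU
    rw [crosses_mk] at hU
    rw [hd, hx]; dsimp only
    by_cases hp : p ∈ U.1 <;> by_cases hp' : p' ∈ U.1 <;> simp [hp, hp'] <;> tauto
  -- Step 1: `(v·x_U)² = ¼ Σ_{(p,q)} v_p v_q d_{p,πp} d_{q,πq}`
  have hsq : ∀ (M : PMatch n) (U : OddSet n), (∑ p, v M p * x U p) ^ 2 =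
      (1 / 4) * ∑ a : Fin n × Fin n, v M a.1 * v M a.2 * (d a.1 (M.2.partner a.1) U * d a.2 (M.2.partner a.2) U) := by
    intro M U
    rw [sum_mul_indicator_eq_half_sum_diff M (v M) (hanti M) (x U), mul_pow, show ((1 : ℝ) / 2) ^ 2 = 1 / 4 by norm_num, sq,
      sum_mul_sum, ← Finset.univ_product_univ, sum_product]
    congr 1
    exact sum_congr rfl fun p _ => sum_congr rfl fun q _ => by rw [hd]; ring
  -- Step 2: re-index the partners: `Σ_{(p',q')} [πp = p' ∧ πq = q']`
  have hreidx : ∀ (M : PMatch n) (U : OddSet n) (a : Fin n × Fin n),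
      v M a.1 * v M a.2 * (d a.1 (M.2.partner a.1) U * d a.2 (M.2.partner a.2) U) =
        ∑ b : Fin n × Fin n, (if (M.2.partner a.1 = b.1 ∧ M.2.partner a.2 = b.2) then v M a.1 * v M a.2 else 0) *
          (d a.1 b.1 U * d a.2 b.2 U) := by
    intro M U a
    rw [Fintype.sum_eq_single (M.2.partner a.1, M.2.partner a.2)]
    · rw [if_pos ⟨rfl, rfl⟩]
    · intro b hb
      rw [if_neg, zero_mul]
      rintro ⟨h1, h2⟩
      exact hb (Prod.ext h1.symm h2.symm)
  -- the summand attached to a quadruple `c = ((p,q),(p',q'))`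
  set Tm : (Fin n × Fin n) × (Fin n × Fin n) → OddSet n → PMatch n → ℝ := fun c U M =>
    levelWeight n (2 * c' + 1) C w U M *
      ((f U * (d c.1.1 c.2.1 U * d c.1.2 c.2.2 U)) *
        (if (M.2.partner c.1.1 = c.2.1 ∧ M.2.partner c.1.2 = c.2.2) then v M c.1.1 * v M c.1.2 else 0)) with hTm
  -- Step 3: the whole sum as `¼ Σ_c Σ_U Σ_M Tm c U M`
  have hexp : ∑ M : PMatch n, ∑ U : OddSet n, levelWeight n (2 * c' + 1) C w U M * (f U * (∑ p, v M p * x U p) ^ 2) =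
      (1 / 4) * ∑ c : (Fin n × Fin n) × (Fin n × Fin n), ∑ U : OddSet n, ∑ M : PMatch n, Tm c U M := by
    have hinner : ∀ (M : PMatch n) (U : OddSet n), levelWeight n (2 * c' + 1) C w U M * (f U * (∑ p, v M p * x U p) ^ 2) =
        (1 / 4) * ∑ c : (Fin n × Fin n) × (Fin n × Fin n), Tm c U M := by
      intro M U
      rw [hsq]
      simp_rw [hreidx]
      rw [Fintype.sum_prod_type (f := fun c : (Fin n × Fin n) × (Fin n × Fin n) => Tm c U M)]
      rw [hTm]
      simp only [mul_sum]
      refine sum_congr rfl fun a _ => sum_congr rfl fun b _ => ?_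
      ring
    simp_rw [hinner]
    simp only [← Finset.mul_sum]
    congr 1
    calc ∑ M : PMatch n, ∑ U : OddSet n, ∑ c : (Fin n × Fin n) × (Fin n × Fin n), Tm c U M
        = ∑ M : PMatch n, ∑ c : (Fin n × Fin n) × (Fin n × Fin n), ∑ U : OddSet n, Tm c U M := sum_congr rfl fun M _ => sum_comm
      _ = ∑ c : (Fin n × Fin n) × (Fin n × Fin n), ∑ M : PMatch n, ∑ U : OddSet n, Tm c U M := sum_comm
      _ = ∑ c : (Fin n × Fin n) × (Fin n × Fin n), ∑ U : OddSet n, ∑ M : PMatch n, Tm c U M :=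
          sum_congr rfl fun c _ => sum_comm
  -- Step 4: each quadruple is a signed scalar crossing cell of the pair `{p,p'}`
  have hcell : ∀ c : (Fin n × Fin n) × (Fin n × Fin n), |∑ U : OddSet n, ∑ M : PMatch n, Tm c U M| ≤ β := by
    intro c
    rw [hTm]
    refine crossingCell_scalar_abs_le hn hdes hD hD4 c.1.1 c.2.1 (fun U => f U * (d c.1.1 c.2.1 U * d c.1.2 c.2.2 U)) (fun U hU => ?_)
      (fun U => ?_) (fun M => if (M.2.partner c.1.1 = c.2.1 ∧ M.2.partner c.1.2 = c.2.2) then v M c.1.1 * v M c.1.2 else 0)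
      (fun M hM => ?_) (fun M => ?_)
    · rw [hdcross _ _ U hU, zero_mul, mul_zero]
    · rw [abs_mul, abs_mul]
      have h1 := hf U; have h2 := hd1 c.1.1 c.2.1 U; have h3 := hd1 c.1.2 c.2.2 U
      have h23 : |d c.1.1 c.2.1 U| * |d c.1.2 c.2.2 U| ≤ 1 := by
        nlinarith [abs_nonneg (d c.1.1 c.2.1 U), abs_nonneg (d c.1.2 c.2.2 U)]
      nlinarith [abs_nonneg (f U), abs_nonneg (d c.1.1 c.2.1 U), abs_nonneg (d c.1.2 c.2.2 U),
        mul_nonneg (abs_nonneg (d c.1.1 c.2.1 U)) (abs_nonneg (d c.1.2 c.2.2 U))]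
    · rw [if_neg]
      rintro ⟨hp, -⟩
      exact hM (hp ▸ M.2.mk_partner_mem c.1.1)
    · split_ifs
      · rw [abs_mul]; have := hv1 M c.1.1; have := hv1 M c.1.2; nlinarith [abs_nonneg (v M c.1.1), abs_nonneg (v M c.1.2)]
      · rw [abs_zero]; exact zero_le_one
  -- Step 5: add up over the `n⁴` quadruples
  rw [hexp, abs_mul, abs_of_pos (by norm_num : (0 : ℝ) < 1 / 4)]
  have h4 : |∑ c : (Fin n × Fin n) × (Fin n × Fin n), ∑ U : OddSet n, ∑ M : PMatch n, Tm c U M| ≤ (n : ℝ) ^ 4 * β := by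
    calc _ ≤ ∑ c : (Fin n × Fin n) × (Fin n × Fin n), β := (abs_sum_le_sum_abs _ _).trans (sum_le_sum fun c _ => hcell c)
      _ = (n : ℝ) ^ 4 * β := by
          rw [sum_const, card_univ, Fintype.card_prod, Fintype.card_prod, Fintype.card_fin, nsmul_eq_mul]; push_cast; ring
  calc 1 / 4 * |∑ c : (Fin n × Fin n) × (Fin n × Fin n), ∑ U : OddSet n, ∑ M : PMatch n, Tm c U M|
      ≤ 1 / 4 * ((n : ℝ) ^ 4 * β) := mul_le_mul_of_nonneg_left h4 (by norm_num)
    _ = (n : ℝ) ^ 4 / 4 * β := by ring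

end Summit.PneNP.PneNP.Theorems.ChebyshevTracialDesignCrossingFormsNull

end
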